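import Mathlib.Analysis.SpecialFunctions.Log.Deriv
import Mathlib.Analysis.Calculus.Deriv.MeanValue
import Mathlib.Algebra.BigOperators.Group.Finset.Basic
import HarnessLib

/-!
# The two-point left-Radau rule bounds `log` from above

Topic `Literature/Analysis/Quadrature`. The logarithm has the integral representation
`log y = ∫₀¹ f_t(y) dt`, `f_t(y) = (y − 1)/(1 + t(y − 1))` (Fawzi–Saunderson–Parrilo §2, eq. (4)); Gauss-type
rules of this integral are the rational models `r(y) = Σ_j w_j f_{t_j}(y)` of the logarithm behind the
semidefinite approximations of the matrix logarithm and of the quantum relative entropy. For CERTIFIED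
(outer) relaxations one needs a rule that bounds `log` FROM ABOVE on all of `(0, ∞)` — the left-Radau
rules (a node at `t = 0`), as `∂_t^{2n−1} f_t(y) ≤ 0` and the left-Radau remainder carries the sign of that
derivative (Cho–Gabai–Sandor–Yin §2.1: "a rigorous bootstrap requires using a quadrature that strictly
bounds `log(x)` from above").

This file PROVES the bound for the rule used by the producers of thermal (energy–entropy-balance)
certificates, WITHOUT quadrature remainder theory:

* `log_le_radauTwo` — the two-point left-Radau rule on `[0,1]` (nodes `0, ⅔`; weights `¼, ¾`):
  `log y ≤ ¼ f_0(y) + ¾ f_{2/3}(y)` for every `y > 0`. Proof: the defect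
  `h(y) = (y−1)/4 + (9/4)(y−1)/(1+2y) − log y` has `h(1) = 0` and `h'(y) = (y−1)³/(y(1+2y)²)`
  (fourth-order contact at `y = 1`), so `h` decreases on `(0,1]` and increases on `[1,∞)`.
* `log_div_le_radauTwo_panel` — the same rule transported to a panel `[a,b] ⊆ [0,1]`:
  `log((1+bs)/(1+as)) ≤ (b−a)[¼ f_a(y) + ¾ f_{a+⅔(b−a)}(y)]`, `s = y − 1`.
* `log_le_radauTwo_composite` — COMPOSITE rule over any partition `0 = a₀ ≤ a₁ ≤ … ≤ a_N = 1`
  (telescoping `log y = Σ_k log((1+a_{k+1}s)/(1+a_k s))`): nodes `a_k`, `a_k + ⅔h_k`, weights `h_k/4`,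
  `3h_k/4` — the `radau2_mesh` rule of the thermal-SDP producers.

The one-point rule (`log y ≤ y − 1`) is Mathlib's `Real.log_le_sub_one_of_pos`. Not here: general
Gauss–Radau remainder theory, higher-order rules, the matrix (operator-concave) versions.

## Mathlib search

REUSED: `Real.hasDerivAt_log`, `HasDerivAt.div/.add/.sub/.const_mul`, `monotoneOn_of_hasDerivWithinAt_nonneg`,
`antitoneOn_of_hasDerivWithinAt_nonpos`, `interior_Ici`, `interior_Ioc`, `Real.log_div`,
`Finset.sum_range_sub`. `lean search 'Radau'`: only docstring mentions under `Literature/Analysis/Quadrature`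
(Gauss family files state exactness/remainders as named facts; no `log` bound) (2026-08-26).

## References

* H. Fawzi, J. Saunderson, P. A. Parrilo, Found. Comput. Math. 19 (2019) 259, §2 eqs. (4)–(6).
  [cite: FawziSaundersonParrilo2019, §2]
* M. Cho, B. Gabai, J. Sandor, X. Yin, JHEP 04 (2025) 186 = arXiv:2410.04262, §2.1.
  [cite: ChoEtAl2025, §2.1]
-/

noncomputable section

namespace Literature.Analysis.Quadrature

open Finset
open scoped BigOperators

/-- `0 < 1 + a(y − 1)` for `a ∈ [0,1]`, `y > 0` (a convex combination of `1` and `y`). [folklore] -/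
private theorem one_add_mul_sub_one_pos {a y : ℝ} (ha0 : 0 ≤ a) (ha1 : a ≤ 1) (hy : 0 < y) :
    0 < 1 + a * (y - 1) := by
  rcases le_or_gt 1 y with h1 | h1
  · have : 0 ≤ a * (y - 1) := mul_nonneg ha0 (by linarith)
    linarith
  · have : a * (1 - y) ≤ 1 - y := mul_le_of_le_one_left (by linarith) ha1
    linarith

/-- Derivative of the defect `h(y) = (y−1)/4 + (9/4)(y−1)/(1+2y) − log y` of the two-point left-Radau
model on `(0, ∞)`: `h'(y) = (y − 1)³/(y(1 + 2y)²)`. [folklore] -/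
private theorem hasDerivAt_radauTwo_defect {y : ℝ} (hy : 0 < y) :
    HasDerivAt (fun u : ℝ => (u - 1) / 4 + 9 / 4 * ((u - 1) / (1 + 2 * u)) - Real.log u)
      ((y - 1) ^ 3 / (y * (1 + 2 * y) ^ 2)) y := by
  have hden : (1 + 2 * y) ≠ 0 := by
    have : 0 < 1 + 2 * y := by linarith
    exact this.ne'
  have hy0 : y ≠ 0 := hy.ne'
  have h1 : HasDerivAt (fun u : ℝ => (u - 1) / 4) (1 / 4) y := by
    simpa using ((hasDerivAt_id y).sub_const (1 : ℝ)).div_const (4 : ℝ)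
  have hnum : HasDerivAt (fun u : ℝ => u - 1) 1 y := by
    simpa using (hasDerivAt_id y).sub_const (1 : ℝ)
  have hden' : HasDerivAt (fun u : ℝ => 1 + 2 * u) 2 y := by
    simpa using ((hasDerivAt_id y).const_mul (2 : ℝ)).const_add (1 : ℝ)
  have h2 : HasDerivAt (fun u : ℝ => (u - 1) / (1 + 2 * u))
      ((1 * (1 + 2 * y) - (y - 1) * 2) / (1 + 2 * y) ^ 2) y := hnum.div hden' hden
  have h3 : HasDerivAt Real.log y⁻¹ y := Real.hasDerivAt_log hy0
  have h : HasDerivAt (fun u : ℝ => (u - 1) / 4 + 9 / 4 * ((u - 1) / (1 + 2 * u)) - Real.log u)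
      (1 / 4 + 9 / 4 * ((1 * (1 + 2 * y) - (y - 1) * 2) / (1 + 2 * y) ^ 2) - y⁻¹) y :=
    (h1.add (h2.const_mul (9 / 4 : ℝ))).sub h3
  refine h.congr_deriv ?_
  field_simp
  ring

/-- The defect of the two-point left-Radau model is nonnegative on `(0, ∞)` (it vanishes at `y = 1`, is
decreasing on `(0,1]` and increasing on `[1,∞)`). [folklore] -/
private theorem radauTwo_defect_nonneg {y : ℝ} (hy : 0 < y) :
    0 ≤ (y - 1) / 4 + 9 / 4 * ((y - 1) / (1 + 2 * y)) - Real.log y := by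
  set h : ℝ → ℝ := fun u => (u - 1) / 4 + 9 / 4 * ((u - 1) / (1 + 2 * u)) - Real.log u with hh
  have h1 : h 1 = 0 := by simp [hh]
  have hcont : ∀ u : ℝ, 0 < u → ContinuousAt h u := fun u hu =>
    (hasDerivAt_radauTwo_defect hu).continuousAt
  change 0 ≤ h y
  rcases le_total 1 y with hy1 | hy1
  · have hmono : MonotoneOn h (Set.Ici 1) := by
      refine monotoneOn_of_hasDerivWithinAt_nonneg (convex_Ici 1)
        (f' := fun u => (u - 1) ^ 3 / (u * (1 + 2 * u) ^ 2)) ?_ ?_ ?_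
      · intro u hu
        exact (hcont u (lt_of_lt_of_le one_pos (Set.mem_Ici.1 hu))).continuousWithinAt
      · intro u hu
        rw [interior_Ici] at hu
        exact (hasDerivAt_radauTwo_defect (lt_trans one_pos (Set.mem_Ioi.1 hu))).hasDerivWithinAt
      · intro u hu
        rw [interior_Ici] at hu
        have hu' : 1 < u := Set.mem_Ioi.1 hu
        have : 0 ≤ (u - 1) ^ 3 := pow_nonneg (by linarith) 3
        positivity
    have := hmono Set.self_mem_Ici (Set.mem_Ici.2 hy1) hy1
    rwa [h1] at this
  · have hanti : AntitoneOn h (Set.Ioc 0 1) := by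
      refine antitoneOn_of_hasDerivWithinAt_nonpos (convex_Ioc 0 1)
        (f' := fun u => (u - 1) ^ 3 / (u * (1 + 2 * u) ^ 2)) ?_ ?_ ?_
      · intro u hu
        exact (hcont u hu.1).continuousWithinAt
      · intro u hu
        rw [interior_Ioc] at hu
        exact (hasDerivAt_radauTwo_defect hu.1).hasDerivWithinAt
      · intro u hu
        rw [interior_Ioc] at hu
        have hneg : (u - 1) ^ 3 ≤ 0 := by
          have hu1 : u - 1 ≤ 0 := by linarith [hu.2]
          calc (u - 1) ^ 3 = (u - 1) * (u - 1) ^ 2 := by ring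
            _ ≤ 0 := mul_nonpos_iff.2 (Or.inr ⟨hu1, sq_nonneg _⟩)
        have hpos : 0 ≤ u * (1 + 2 * u) ^ 2 := by
          have := hu.1
          positivity
        exact div_nonpos_of_nonpos_of_nonneg hneg hpos
    have := hanti ⟨hy, hy1⟩ ⟨one_pos, le_refl 1⟩ hy1
    rwa [h1] at this

/-- **`log` lies below the two-point left-Radau model.** For every `y > 0`:
`log y ≤ ¼·(y − 1)/(1 + 0·(y−1)) + ¾·(y − 1)/(1 + ⅔(y − 1))`, the two-point left-Radau rule (nodes
`0, ⅔`, weights `¼, ¾`, exact for cubics in `t`) of `log y = ∫₀¹ (y−1)/(1+t(y−1)) dt`; the defect has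
derivative `(y−1)³/(y(1+2y)²)` and vanishes to fourth order at `y = 1`. The one-point rule is Mathlib's
`Real.log_le_sub_one_of_pos`. [cite: ChoEtAl2025, §2.1] -/
theorem log_le_radauTwo {y : ℝ} (hy : 0 < y) :
    Real.log y ≤
      1 / 4 * ((y - 1) / (1 + 0 * (y - 1))) + 3 / 4 * ((y - 1) / (1 + 2 / 3 * (y - 1))) := by
  have h := radauTwo_defect_nonneg hy
  set q : ℝ := 1 + 2 * y with hq_def
  have hq0 : q ≠ 0 := by
    have : 0 < q := by rw [hq_def]; linarith
    exact this.ne'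
  have hq : 1 + 2 / 3 * (y - 1) = q / 3 := by rw [hq_def]; ring
  have h34 : 3 / 4 * ((y - 1) / (q / 3)) = 9 / 4 * ((y - 1) / q) := by
    field_simp
    ring
  rw [hq, zero_mul, add_zero, div_one, h34]
  linarith

/-- **Panel form.** For a panel `[a, b] ⊆ [0, 1]` and `y > 0`, `s = y − 1`:
`log((1 + b s)/(1 + a s)) ≤ (b − a)·[¼·s/(1 + a s) + ¾·s/(1 + (a + ⅔(b−a)) s)]` — the two-point left-Radau
rule of `∫_a^b s/(1+ts) dt`, i.e. `log_le_radauTwo` at `y' = (1+bs)/(1+as)`. [cite: ChoEtAl2025, §2.1] -/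
theorem log_div_le_radauTwo_panel {a b y : ℝ} (ha : 0 ≤ a) (hab : a ≤ b) (hb : b ≤ 1) (hy : 0 < y) :
    Real.log ((1 + b * (y - 1)) / (1 + a * (y - 1))) ≤
      (b - a) * (1 / 4 * ((y - 1) / (1 + a * (y - 1))) +
        3 / 4 * ((y - 1) / (1 + (a + 2 / 3 * (b - a)) * (y - 1)))) := by
  have hpa : 0 < 1 + a * (y - 1) := one_add_mul_sub_one_pos ha (hab.trans hb) hy
  have hpb : 0 < 1 + b * (y - 1) := one_add_mul_sub_one_pos (ha.trans hab) hb hy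
  have hpc : 0 < 1 + (a + 2 / 3 * (b - a)) * (y - 1) :=
    one_add_mul_sub_one_pos (by nlinarith) (by nlinarith) hy
  have hy' : 0 < (1 + b * (y - 1)) / (1 + a * (y - 1)) := div_pos hpb hpa
  have key := log_le_radauTwo hy'
  rw [zero_mul, add_zero, div_one] at key
  -- make the two denominators atomic
  set p : ℝ := 1 + a * (y - 1) with hp_def
  set q : ℝ := 1 + (a + 2 / 3 * (b - a)) * (y - 1) with hq_def
  have hp0 : p ≠ 0 := hpa.ne'
  have hq0 : q ≠ 0 := hpc.ne'
  have hY : (1 + b * (y - 1)) / p - 1 = (b - a) * (y - 1) / p := by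
    rw [div_sub_one hp0, hp_def]
    ring_nf
  have hq : 1 + 2 / 3 * ((b - a) * (y - 1) / p) = q / p := by
    rw [eq_div_iff hp0]
    have hc : (b - a) * (y - 1) / p * p = (b - a) * (y - 1) := div_mul_cancel₀ _ hp0
    calc (1 + 2 / 3 * ((b - a) * (y - 1) / p)) * p = p + 2 / 3 * ((b - a) * (y - 1) / p * p) := by ring
      _ = p + 2 / 3 * ((b - a) * (y - 1)) := by rw [hc]
      _ = q := by rw [hp_def, hq_def]; ring
  rw [hY, hq] at key
  calc Real.log ((1 + b * (y - 1)) / p)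
      ≤ 1 / 4 * ((b - a) * (y - 1) / p) + 3 / 4 * ((b - a) * (y - 1) / p / (q / p)) := key
    _ = (b - a) * (1 / 4 * ((y - 1) / p) + 3 / 4 * ((y - 1) / q)) := by
        field_simp

/-- **Composite two-point left-Radau rule.** For a partition `0 = a₀ ≤ a₁ ≤ … ≤ a_N = 1` and `y > 0`,
`s = y − 1`:
`log y ≤ Σ_{k<N} (a_{k+1} − a_k)·[¼·s/(1 + a_k s) + ¾·s/(1 + (a_k + ⅔(a_{k+1}−a_k)) s)]`
(telescoping `log y = Σ_k log((1+a_{k+1}s)/(1+a_k s))` + the panel form) — the thermal-SDP producers'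
`radau2_mesh` rule: nodes `a_k`, `a_k + ⅔h_k`, weights `h_k/4`, `3h_k/4`. [cite: ChoEtAl2025, §2.1] -/
theorem log_le_radauTwo_composite (a : ℕ → ℝ) (N : ℕ) (hmono : Monotone a) (h0 : a 0 = 0)
    (hN : a N = 1) {y : ℝ} (hy : 0 < y) :
    Real.log y ≤ ∑ k ∈ Finset.range N, (a (k + 1) - a k) *
      (1 / 4 * ((y - 1) / (1 + a k * (y - 1))) +
        3 / 4 * ((y - 1) / (1 + (a k + 2 / 3 * (a (k + 1) - a k)) * (y - 1)))) := by
  have hak0 : ∀ k, 0 ≤ a k := fun k => h0 ▸ hmono (Nat.zero_le k)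
  have hak1 : ∀ k, k ≤ N → a k ≤ 1 := fun k hk => hN ▸ hmono hk
  have hpos : ∀ k, k ≤ N → 0 < 1 + a k * (y - 1) := fun k hk =>
    one_add_mul_sub_one_pos (hak0 k) (hak1 k hk) hy
  -- telescoping
  have htel : Real.log y =
      ∑ k ∈ Finset.range N, (Real.log (1 + a (k + 1) * (y - 1)) - Real.log (1 + a k * (y - 1))) := by
    rw [Finset.sum_range_sub (fun k => Real.log (1 + a k * (y - 1))) N, hN, h0]
    simp
  rw [htel]
  refine Finset.sum_le_sum fun k hk => ?_
  have hkN : k + 1 ≤ N := Finset.mem_range.1 hk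
  rw [← Real.log_div (hpos (k + 1) hkN).ne' (hpos k (by omega)).ne']
  exact log_div_le_radauTwo_panel (hak0 k) (hmono (Nat.le_succ k)) (hak1 (k + 1) hkN) hy

end Literature.Analysis.Quadrature

end
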